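import Mathlib
import HarnessLib
import Summits.KontsevichZagierPeriods.Zeta5Search.TwoTaleRungADecay
import Summits.KontsevichZagierPeriods.Zeta5Search.Denom.TwoTaleP15StripShift

/-!
# Rung A `(6,5,4,7 | 0,1,2,12)` — the strip shift PROVED, and `DecayA c` from one half-line bound

HONEST FRAMING: systematic search; no irrationality claim unless certified.  Cell pub-zeta5, class
`measure` (fam-measure g4), T3/T4.  Pure complex analysis, no measure or irrationality claim: this file
discharges the strip-shift hypothesis `hShift` of `TwoTaleRungADecay.decayA_of_lineBound` — the vertical
line of the Barnes-type integral `lineIntegralA n x = (1/2π) ∫ (π/sin π(x+iy))² Rₙ(x − a₂* + iy) dy`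
([Zudilin2014ZetaTwo, Prop. 1 (P4)] at Zudilin's Remark-3 rung `a = (6n+1, 5n+1, 4n+1, 7n+1)`,
`b = (1, n+1, 2n+1, 12n+2)`, `a₂* = 5n+1`) may be moved from `x = ½` to any half-integer abscissa
`x = m + ½`, `m ≤ 4n` — exactly as `Denom/TwoTaleP15StripShift` does at the point P15.

Method: iterate fam-denom's abstract unit step `KernelStripStep.integral_kernel_step` over `m = 1, …, 4n`.
At each such `m` the shifted rational function `g(t) = Rₙ(t − a₂*)` has a DOUBLE zero (the factor
`t − a₂* + i`, `i = a₂* − m ∈ [n+1, 5n]`, occurs in the numerator blocks `i ∈ [1, 6n]` and `i ∈ [n+1, 5n]`),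
is holomorphic on `Re t ≥ ½` (the polar factors `t − a₂* + i`, `i ≥ 7n+1`, have real part `≥ 2n + ½`), and is
bounded by `A·(1 + (Im t)²)^{6n}` on each strip (a product of `12n` linear factors over a polar block of
norm `≥ 1`).  The general Literature function `Zudilin2014.RC` is first rewritten as a product of
`ℕ`-indexed blocks (`gA_eq`).

Main results: `stripShiftA_holds : ∀ n ≥ 1, ∀ m ≤ 4n, lineIntegralA n (m + ½) = lineIntegralA n ½`;
the corollary `decayA_of_halfLineBound` = `decayA_of_lineBound` with the strip shift discharged (the one
remaining input, an eventual bound on one half-line, is `TwoTaleRungALineRate`/`…LineDecay` + fam-denom's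
one-variable certificate).
References: W. Zudilin, arXiv:1310.1526 [Zudilin2014ZetaTwo] Prop. 1, Lemma 6, Remark 3.
-/

noncomputable section

open Complex Set MeasureTheory Filter Topology Finset Polynomial
open Literature.NumberTheory.Transcendental
open Literature.NumberTheory.Irrationality.Zudilin2014
open Summit.KontsevichZagierPeriods.Zeta5Search
open Summit.KontsevichZagierPeriods.Zeta5Search.Denom
open Summit.KontsevichZagierPeriods.Zeta5Search.Denom.TwoTaleR3Forms
open Summit.KontsevichZagierPeriods.Zeta5Search.Denom.TwoTaleP15Decay (kernelSq)
open Summit.KontsevichZagierPeriods.Zeta5Search.Denom.KernelStripStep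
open Summit.KontsevichZagierPeriods.Zeta5Search.Denom.TwoTaleP15StripShift
  (half_le_re_of_mem_halfStrip one_add_abs_sq_le_two_mul)
open Summit.KontsevichZagierPeriods.Zeta5Search.TwoTaleRungADecay

namespace Summit.KontsevichZagierPeriods.Zeta5Search.TwoTaleRungAStripShift

/-! ### The blocks of `Rₙ(t − a₂*)` -/

/-- An `ℕ`-indexed block `∏_{i ∈ [lo, hi)} (t − a₂* + i)` of `Rₙ(t − a₂*)`, `a₂* = 5n + 1`. -/
def aBlock (n lo hi : ℕ) (t : ℂ) : ℂ := ∏ i ∈ Ico lo hi, (t - (5 * n + 1) + i)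

/-- The shifted rational function `g(t) = Rₙ(t − a₂*)` at rung A. -/
def gA (n : ℕ) (t : ℂ) : ℂ := ratRCA n (t - (5 * n + 1))

/-- A Literature `ℤ`-indexed block with natural end-points, evaluated at `t − a₂*`, is the `ℕ`-block. -/
theorem aeval_block_eq_aBlock (n lo hi : ℕ) (t : ℂ) :
    aeval (t - (5 * n + 1)) (block (lo : ℤ) (hi : ℤ)) = aBlock n lo hi t := by
  rw [aeval_block_complex, TwoTaleP15Bridge.Ico_natCast_eq_map, Finset.prod_map]
  simp only [Nat.castEmbedding_apply, Int.cast_natCast]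
  rfl

/-- **`g` as a product of blocks**: `Rₙ(t − a₂*) = Π · B[1,6n]·B[n+1,5n]·B[2n+1,4n] / B[7n+1,12n+1]`
(`Π = Zudilin2014.Pi (aRungA n) (bRungA n)`, a non-zero rational constant). -/
theorem gA_eq (n : ℕ) (t : ℂ) : gA n t =
    ((Pi (aRungA n) (bRungA n) : ℚ) : ℂ) *
      (aBlock n 1 (6 * n + 1) t * aBlock n (n + 1) (5 * n + 1) t * aBlock n (2 * n + 1) (4 * n + 1) t) /
      aBlock n (7 * n + 1) (12 * n + 2) t := by
  have e0 : bRungA n 0 = ((1 : ℕ) : ℤ) := by simp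
  have e0' : aRungA n 0 = ((6 * n + 1 : ℕ) : ℤ) := by rw [aRungA_zero]; push_cast; ring
  have e1 : bRungA n 1 = ((n + 1 : ℕ) : ℤ) := by rw [bRungA_one]; push_cast; ring
  have e1' : aRungA n 1 = ((5 * n + 1 : ℕ) : ℤ) := by rw [aRungA_one]; push_cast; ring
  have e2 : bRungA n 2 = ((2 * n + 1 : ℕ) : ℤ) := by rw [bRungA_two]; push_cast; ring
  have e2' : aRungA n 2 = ((4 * n + 1 : ℕ) : ℤ) := by rw [aRungA_two]; push_cast; ring
  have e3 : aRungA n 3 = ((7 * n + 1 : ℕ) : ℤ) := by rw [aRungA_three]; push_cast; ring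
  have e3' : bRungA n 3 = ((12 * n + 2 : ℕ) : ℤ) := by rw [bRungA_three]; push_cast; ring
  unfold gA ratRCA RC num den
  rw [map_mul, map_mul, e0, e0', e1, e1', e2, e2', e3, e3', aeval_block_eq_aBlock, aeval_block_eq_aBlock,
    aeval_block_eq_aBlock, aeval_block_eq_aBlock]

/-- Each block is entire. -/
@[fun_prop]
theorem differentiable_aBlock (n lo hi : ℕ) : Differentiable ℂ (aBlock n lo hi) := by
  unfold aBlock
  fun_prop

/-- Real part of a factor: `Re (t − a₂* + i) = Re t − 5n − 1 + i`. -/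
theorem re_aFactor (n i : ℕ) (t : ℂ) : (t - (5 * n + 1) + i).re = t.re - (5 * n + 1) + i := by
  have : (t - (5 * n + 1) + i : ℂ) = t + (((i : ℝ) - (5 * n + 1) : ℝ) : ℂ) := by
    push_cast
    ring
  rw [this, add_re, ofReal_re]
  ring

/-- A polar factor has real part `≥ 2n + ½` on `Re t ≥ ½`. -/
theorem re_aFactor_ge {n i : ℕ} (hi : 7 * n + 1 ≤ i) {t : ℂ} (ht : 1 / 2 ≤ t.re) :
    2 * n + 1 / 2 ≤ (t - (5 * n + 1) + i).re := by
  have h : ((7 * n + 1 : ℕ) : ℝ) ≤ (i : ℝ) := by exact_mod_cast hi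
  push_cast at h
  rw [re_aFactor]
  linarith

/-- The polar block does not vanish on `Re t ≥ ½`. -/
theorem aPolar_ne_zero {n : ℕ} {t : ℂ} (ht : 1 / 2 ≤ t.re) : aBlock n (7 * n + 1) (12 * n + 2) t ≠ 0 := by
  rw [aBlock]
  refine Finset.prod_ne_zero_iff.2 fun i hi h => ?_
  have h1 := re_aFactor_ge (n := n) (Finset.mem_Ico.1 hi).1 ht
  rw [h, zero_re] at h1
  have : (0 : ℝ) ≤ 2 * n := by positivity
  linarith

/-- The polar block has norm `≥ 1` on `Re t ≥ ½` (`n ≥ 1`). -/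
theorem one_le_norm_aPolar {n : ℕ} (hn : 1 ≤ n) {t : ℂ} (ht : 1 / 2 ≤ t.re) :
    1 ≤ ‖aBlock n (7 * n + 1) (12 * n + 2) t‖ := by
  rw [aBlock, norm_prod]
  refine Finset.one_le_prod fun i hi => ?_
  have h1 := re_aFactor_ge (n := n) (Finset.mem_Ico.1 hi).1 ht
  have hn' : (1 : ℝ) ≤ n := by exact_mod_cast hn
  exact le_trans (by linarith) (re_le_norm _)

/-- A block containing the index `a₂* − m` vanishes at `t = m`. -/
theorem aBlock_natCast_eq_zero {n lo hi m : ℕ} (hlo : lo + m ≤ 5 * n + 1) (hhi : 5 * n + 1 < hi + m) :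
    aBlock n lo hi (m : ℂ) = 0 := by
  rw [aBlock]
  have hm : m ≤ 5 * n + 1 := by omega
  refine Finset.prod_eq_zero (i := 5 * n + 1 - m) (Finset.mem_Ico.2 ⟨by omega, by omega⟩) ?_
  rw [Nat.cast_sub hm]
  push_cast
  ring

/-! ### The hypotheses of the unit step at `m = 1, …, 4n` -/

/-- `g` as a function (for `fun_prop` and the product rule). -/
theorem gA_eq_fun (n : ℕ) : gA n = fun t => ((Pi (aRungA n) (bRungA n) : ℚ) : ℂ) *
    (aBlock n 1 (6 * n + 1) t * aBlock n (n + 1) (5 * n + 1) t * aBlock n (2 * n + 1) (4 * n + 1) t) /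
    aBlock n (7 * n + 1) (12 * n + 2) t :=
  funext (gA_eq n)

/-- `g(m) = 0` for `1 ≤ m ≤ 4n`. -/
theorem gA_natCast {n m : ℕ} (h1 : 1 ≤ m) (h4 : m ≤ 4 * n) : gA n (m : ℂ) = 0 := by
  rw [gA_eq, aBlock_natCast_eq_zero (lo := 1) (hi := 6 * n + 1) (by omega) (by omega)]
  simp

/-- `g` is holomorphic on the closed strip `|Re t − m| ≤ ½`, `m ≥ 1`. -/
theorem differentiableOn_gA (n : ℕ) {m : ℕ} (h1 : 1 ≤ m) : DifferentiableOn ℂ (gA n) (halfStrip (m : ℤ)) := by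
  have hden : ∀ t ∈ halfStrip (m : ℤ), aBlock n (7 * n + 1) (12 * n + 2) t ≠ 0 :=
    fun t ht => aPolar_ne_zero (half_le_re_of_mem_halfStrip h1 ht)
  rw [gA_eq_fun]
  fun_prop (disch := first | assumption | exact hden)

/-- `g'(m) = 0` for `1 ≤ m ≤ 4n` (two vanishing blocks ⇒ every term of the product rule vanishes). -/
theorem deriv_gA_natCast {n m : ℕ} (h1 : 1 ≤ m) (h4 : m ≤ 4 * n) : deriv (gA n) (m : ℂ) = 0 := by
  have hB1 : aBlock n 1 (6 * n + 1) (m : ℂ) = 0 := aBlock_natCast_eq_zero (by omega) (by omega)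
  have hB2 : aBlock n (n + 1) (5 * n + 1) (m : ℂ) = 0 := aBlock_natCast_eq_zero (by omega) (by omega)
  have hre : 1 / 2 ≤ (m : ℂ).re := by
    rw [natCast_re]
    have : (1 : ℝ) ≤ m := by exact_mod_cast h1
    linarith
  have hden : aBlock n (7 * n + 1) (12 * n + 2) (m : ℂ) ≠ 0 := aPolar_ne_zero hre
  have hA : HasDerivAt (aBlock n 1 (6 * n + 1)) _ (m : ℂ) :=
    (differentiable_aBlock n 1 (6 * n + 1)).differentiableAt.hasDerivAt
  have hB : HasDerivAt (aBlock n (n + 1) (5 * n + 1)) _ (m : ℂ) :=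
    (differentiable_aBlock n (n + 1) (5 * n + 1)).differentiableAt.hasDerivAt
  have hC : HasDerivAt (aBlock n (2 * n + 1) (4 * n + 1)) _ (m : ℂ) :=
    (differentiable_aBlock n (2 * n + 1) (4 * n + 1)).differentiableAt.hasDerivAt
  have hD : HasDerivAt (aBlock n (7 * n + 1) (12 * n + 2)) _ (m : ℂ) :=
    (differentiable_aBlock n (7 * n + 1) (12 * n + 2)).differentiableAt.hasDerivAt
  have h := (((hA.mul hB).mul hC).const_mul (((Pi (aRungA n) (bRungA n) : ℚ) : ℂ))).div hD hden
  rw [gA_eq_fun]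
  refine h.deriv.trans ?_
  simp [hB1, hB2]

/-! ### Polynomial growth on the strips -/

/-- A linear factor on the strip around `m ≤ 4n`: `‖t − a₂* + i‖ ≤ (21n + 3)(1 + |Im t|)` for `i < 12n + 2`. -/
theorem norm_aFactor_le {n m i : ℕ} (hm : m ≤ 4 * n) (hi : i < 12 * n + 2) {t : ℂ}
    (ht : t ∈ halfStrip (m : ℤ)) : ‖t - (5 * n + 1) + i‖ ≤ (21 * n + 3) * (1 + |t.im|) := by
  simp only [halfStrip, Set.mem_preimage, Set.mem_Icc, Int.cast_natCast] at ht
  have hm' : (m : ℝ) ≤ 4 * n := by exact_mod_cast hm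
  have hi' : (i : ℝ) ≤ 12 * n + 1 := by
    have : i ≤ 12 * n + 1 := by omega
    exact_mod_cast this
  have hn : (0 : ℝ) ≤ n := Nat.cast_nonneg n
  have h1 : ‖t - (5 * n + 1) + i‖ ≤ ‖t‖ + ‖((5 * n + 1 : ℕ) : ℂ)‖ + ‖(i : ℂ)‖ := by
    calc ‖t - (5 * n + 1) + i‖ ≤ ‖t - (5 * n + 1)‖ + ‖(i : ℂ)‖ := norm_add_le _ _
      _ ≤ ‖t‖ + ‖((5 * n + 1 : ℕ) : ℂ)‖ + ‖(i : ℂ)‖ := by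
          gcongr
          push_cast
          exact norm_sub_le _ _
  rw [Complex.norm_natCast, Complex.norm_natCast] at h1
  push_cast at h1
  have h2 : ‖t‖ ≤ |t.re| + |t.im| := norm_le_abs_re_add_abs_im t
  have h3 : |t.re| ≤ 4 * n + 1 := by
    rw [abs_le]
    constructor <;> linarith [ht.1, ht.2]
  have h4 : 0 ≤ |t.im| := abs_nonneg _
  nlinarith [mul_nonneg (by positivity : (0 : ℝ) ≤ 21 * n + 2) h4]

/-- A block on the strip around `m ≤ 4n`: `‖aBlock n lo hi t‖ ≤ ((21n+3)(1+|Im t|))^{hi − lo}` (`hi ≤ 12n+2`). -/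
theorem norm_aBlock_le {n m lo hi : ℕ} (hm : m ≤ 4 * n) (hhi : hi ≤ 12 * n + 2) {t : ℂ}
    (ht : t ∈ halfStrip (m : ℤ)) : ‖aBlock n lo hi t‖ ≤ ((21 * n + 3) * (1 + |t.im|)) ^ (hi - lo) := by
  rw [aBlock, norm_prod, ← Nat.card_Ico lo hi, ← Finset.prod_const]
  refine Finset.prod_le_prod (fun i _ => norm_nonneg _) fun i hi' => ?_
  exact norm_aFactor_le hm (by have := (Finset.mem_Ico.1 hi').2; omega) ht

/-- **Growth**: on the strip around `m ∈ [1, 4n]`, `‖g(t)‖ ≤ A · (1 + (Im t)²)^{6n}` with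
`A = |Π| (21n+3)^{12n} 2^{6n}`. -/
theorem norm_gA_le {n m : ℕ} (hn : 1 ≤ n) (h1 : 1 ≤ m) (hm : m ≤ 4 * n) {t : ℂ} (ht : t ∈ halfStrip (m : ℤ)) :
    ‖gA n t‖ ≤ (‖((Pi (aRungA n) (bRungA n) : ℚ) : ℂ)‖ * (21 * n + 3) ^ (12 * n) * 2 ^ (6 * n)) *
      (1 + t.im ^ 2) ^ (6 * n) := by
  have hre : 1 / 2 ≤ t.re := half_le_re_of_mem_halfStrip h1 ht
  set b : ℝ := (21 * n + 3) * (1 + |t.im|) with hb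
  have hb1 : 1 ≤ 1 + |t.im| := le_add_of_nonneg_right (abs_nonneg _)
  have hB1 := norm_aBlock_le (lo := 1) (hi := 6 * n + 1) hm (by omega) ht
  have hB2 := norm_aBlock_le (lo := n + 1) (hi := 5 * n + 1) hm (by omega) ht
  have hB3 := norm_aBlock_le (lo := 2 * n + 1) (hi := 4 * n + 1) hm (by omega) ht
  have e1 : 6 * n + 1 - 1 = 6 * n := by omega
  have e2 : 5 * n + 1 - (n + 1) = 4 * n := by omega
  have e3 : 4 * n + 1 - (2 * n + 1) = 2 * n := by omega
  rw [e1] at hB1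
  rw [e2] at hB2
  rw [e3] at hB3
  have hD := one_le_norm_aPolar hn hre
  have h12 : 12 * n = 2 * (6 * n) := by ring
  set P : ℝ := ‖((Pi (aRungA n) (bRungA n) : ℚ) : ℂ)‖ with hP
  have hP0 : 0 ≤ P := norm_nonneg _
  calc ‖gA n t‖
      = P * (‖aBlock n 1 (6 * n + 1) t‖ * ‖aBlock n (n + 1) (5 * n + 1) t‖ *
          ‖aBlock n (2 * n + 1) (4 * n + 1) t‖) / ‖aBlock n (7 * n + 1) (12 * n + 2) t‖ := by
        rw [gA_eq]
        simp only [norm_mul, norm_div, hP]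
    _ ≤ P * (‖aBlock n 1 (6 * n + 1) t‖ * ‖aBlock n (n + 1) (5 * n + 1) t‖ *
          ‖aBlock n (2 * n + 1) (4 * n + 1) t‖) := div_le_self (by positivity) hD
    _ ≤ P * (b ^ (6 * n) * b ^ (4 * n) * b ^ (2 * n)) := by gcongr
    _ = P * ((21 * n + 3) ^ (12 * n) * (1 + |t.im|) ^ (12 * n)) := by
        simp only [hb, mul_pow]
        ring
    _ ≤ P * ((21 * n + 3) ^ (12 * n) * (2 ^ (6 * n) * (1 + t.im ^ 2) ^ (6 * n))) := by
        have h2 : (1 + |t.im|) ^ (12 * n) ≤ 2 ^ (6 * n) * (1 + t.im ^ 2) ^ (6 * n) := by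
          rw [h12, pow_mul, ← mul_pow]
          exact pow_le_pow_left₀ (by positivity) (one_add_abs_sq_le_two_mul t.im) _
        exact mul_le_mul_of_nonneg_left (mul_le_mul_of_nonneg_left h2 (by positivity)) hP0
    _ = (P * (21 * n + 3) ^ (12 * n) * 2 ^ (6 * n)) * (1 + t.im ^ 2) ^ (6 * n) := by ring

/-! ### The strip shift -/

/-- The integrand of `lineIntegralA n x` is the kernel times `g`. -/
theorem lineIntegrandA_eq_kernel_mul_gA (n : ℕ) (x y : ℝ) :
    kernelSq ((x : ℂ) + (y : ℂ) * I) * ratRCA n ((x : ℂ) - (5 * n + 1) + (y : ℂ) * I) =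
      ((Real.pi : ℂ) / Complex.sin (Real.pi * ((x : ℂ) + (y : ℂ) * I))) ^ 2 * gA n ((x : ℂ) + (y : ℂ) * I) := by
  rw [kernelSq, gA, add_sub_right_comm]

/-- **One step**: the line `k + 1 + ½` equals the line `k + ½` (`k + 1 ≤ 4n`). -/
theorem lineIntegralA_succ {n k : ℕ} (hn : 1 ≤ n) (hk : k + 1 ≤ 4 * n) :
    lineIntegralA n (((k + 1 : ℕ) : ℝ) + 1 / 2) = lineIntegralA n ((k : ℝ) + 1 / 2) := by
  have h1 : 1 ≤ k + 1 := by omega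
  have eL : ((((k + 1 : ℕ) : ℤ) : ℝ) - 1 / 2 : ℝ) = (k : ℝ) + 1 / 2 := by
    push_cast
    ring
  have eR : ((((k + 1 : ℕ) : ℤ) : ℝ) + 1 / 2 : ℝ) = ((k + 1 : ℕ) : ℝ) + 1 / 2 := by
    push_cast
    ring
  have e0 : ((((k + 1 : ℕ) : ℤ)) : ℂ) = ((k + 1 : ℕ) : ℂ) := by norm_cast
  have h0 : gA n ((((k + 1 : ℕ) : ℤ)) : ℂ) = 0 := by
    rw [e0]
    exact gA_natCast h1 hk
  have h0' : deriv (gA n) ((((k + 1 : ℕ) : ℤ)) : ℂ) = 0 := by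
    rw [e0]
    exact deriv_gA_natCast h1 hk
  have step := integral_kernel_step (differentiableOn_gA n h1) h0 h0' (fun t ht => norm_gA_le hn h1 hk ht)
  rw [eL, eR] at step
  unfold lineIntegralA
  simp_rw [lineIntegrandA_eq_kernel_mul_gA]
  rw [step]

/-- **The strip shift at rung A, PROVED**: `lineIntegralA n (m + ½) = lineIntegralA n ½` for all `m ≤ 4n`
(`n ≥ 1`) — the hypothesis `hShift` of `TwoTaleRungADecay.decayA_of_lineBound`. -/
theorem stripShiftA_holds :
    ∀ n : ℕ, 1 ≤ n → ∀ m : ℕ, m ≤ 4 * n → lineIntegralA n ((m : ℝ) + 1 / 2) = lineIntegralA n (1 / 2) := by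
  intro n hn m hm
  induction m with
  | zero => simp
  | succ k ih => rw [lineIntegralA_succ hn (by omega), ih (by omega)]

/-! ### Corollary: `DecayA c` from ONE eventual half-line bound -/

/-- **`DecayA c` from one line bound** (`decayA_of_lineBound` with the line representation and the strip shift
both discharged): if on some half-integer line `xₙ + ½`, `xₙ ≤ 4n`, eventually
`(π/2) ∫ |Rₙ(xₙ + ½ − a₂* + iy)|/cosh²(πy) dy ≤ e^{−cn}`, then `DecayA c`. -/
theorem decayA_of_halfLineBound {c : ℝ} (x : ℕ → ℕ) (hx : ∀ n, x n ≤ 4 * n)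
    (hB : ∀ᶠ n : ℕ in atTop, Real.pi / 2 *
      ∫ y : ℝ, ‖ratRCA n ((((x n : ℝ) + 1 / 2 : ℝ) : ℂ) - (5 * n + 1) + (y : ℂ) * I)‖ /
        Real.cosh (Real.pi * y) ^ 2 ≤ Real.exp (-(c * n))) :
    DecayA c :=
  decayA_of_lineBound stripShiftA_holds x hx hB

end Summit.KontsevichZagierPeriods.Zeta5Search.TwoTaleRungAStripShift

end
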